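import Summits.CriticalPhenomena.PercolationContinuityZ3.Theorems.PercNearOneGluingNoHeavyLowerTailSahiHubTwoLevelSquare
import Summits.CriticalPhenomena.PercolationContinuityZ3.Theorems.PercNearOneGluingNoHeavyLowerTailSahiHubTwoLevelSquareRules
import Summits.CriticalPhenomena.PercolationContinuityZ3.Theorems.PercNearOneGluingNoHeavyLowerTailSahiHubTwoLevelOneLevelLaw
import Summits.CriticalPhenomena.PercolationContinuityZ3.Theorems.PercNearOneGluingNoHeavyLowerTailSahiHubTwoLevelE3
import Mathlib.Tactic.Linarith
import Mathlib.Tactic.Positivity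
import Mathlib.Tactic.FieldSimp
import Mathlib.Tactic.Ring
import HarnessLib

/-!
# `NoHeavyLowerTail` (crux stmt-CriticalPhenomena-4575), P2 — **`I3 ≥ 0`: THE BIAS-FREE CROSS FORM IS NONNEGATIVE; T₁(|C|=1) AND
# KAHN'S `C₃` FOR `f(z,c,a), g(z,c,b), h(z,a,b)` ARE UNCONDITIONAL**

Seat `prim-masterthm-p2`, gen 29 (memo `FROM-prim-masterthm-p2-g29-SQUARE-IDENTITY.md`; `--supports stmt-CriticalPhenomena-4575`).
No `sorry`, no named facts, standard axioms.

By `…SahiHubTwoLevelSquare`, `I3 = Σ_b wB S^ρ(b) + CPart ρ + Rpart ρ` for every ratio `ρ` on the (z,c)-square, and `I3 ≥ 0` as soon as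
some `ρ ∈ [0,1]^4` has `S^ρ(b) ≥ 0` at every fibre and `Rpart ρ ≥ 0`.  THIS FILE exhibits such a `ρ` for EVERY datum.  With
`F_0 = Fm 0 0, F_Z = Fm 0 1, F_C = Fm 1 0, F_T = Fm 1 1` (section means at the square points `0, Z, C, T`) and `ρ = (ρ_0,ρ_Z,ρ_C,ρ_T)`:
* case A (`G_Z ≥ G_C`): `ρ = (0, 0, (F_C−F_Z)/F_T, 1−F_0/F_T)` if `F_Z ≤ F_C`, `ρ = (0, 1−F_C/F_Z, 0, 1−F_0/F_T)` if `F_Z > F_C`;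
* case B (`G_Z < G_C`): `ρ = (0, 0, (F_C−F_Z)/F_C, 1−F_0/F_T)` if `F_Z < F_C`, `ρ = (0, (F_Z−F_C)/F_T, 0, 1−F_0/F_T)` if `F_Z ≥ F_C`
(h-FREE and G-free apart from the sign of `G_Z − G_C`; found as vertices of the "h-free master LP", memo §5).
* THE SQUARE LEMMA (`…SquareRules`: `sq_core` + the pattern certificates `patT`, `patZCT`, `patAll`, `patZT_*`, `patCT_*`): for these `ρ` the antipodal
  sum `S^ρ(b) = Σ_x g_x(b)T_x(b)` is `≥ 0` at every fibre, by the layer-cake decomposition of the monotone pattern `x ↦ g_x(b)` on the square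
  and EXPLICIT nonnegative combinations of the fibre facts `Y_x ≥ F_xH_{z(x)}` (FKG on `α`), `Y` monotone on the square, `0 ≤ H_0 ≤ H_1`.
* THE REMAINDER (`…SquareRules`: `R_core_A/B`, `DT0_rule`, `DZC_*`): `Rpart = (G_T−G_0)D_{T0} + (G_Z−G_C)D_{ZC} + (F_T−F_Z)(G_T−G_Z)ΔH̄` with `D_{T0} ≥ 0` always,
  `D_{T0}+D_{ZC} ≥ 0` in case A and `D_{T0} − D_{ZC} + (F_T−F_Z)ΔH̄ ≥ 0` in case B.
* **`crossForm_nonneg` (`I3 ≥ 0`)**, **`twoLevel_nonneg` (the hub two-level form is `≥ 0` at every hub bias)** and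
  **`sahiE_three_nonneg_T1C1`: Sahi/Kahn `E₃ ≥ 0` for every triple `f(z,c,a), g(z,c,b), h(z,a,b)` of nonnegative bounded functions,
  monotone in every argument, over FKG blocks `α, β` and ANY product weight on the two coins `(z,c)`** — the class T₁(|C|=1) of the
  programme (two members share exactly two coordinates, one of which is seen by the third), previously open (gens 25–28).
HONEST LABEL: T₁(|C|=1) PROVED; Kahn's `C₃` in general (more shared coordinates) OPEN. [this work]
-/

noncomputable section

open scoped Classical

namespace Summit.CriticalPhenomena.PercolationContinuityZ3.Theorems

namespace SahiHubTwoLevel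

open Finset Literature.Combinatorics.Sahi2008

/-! ## The explicit ratios and the main theorem -/
section Main

variable {α β : Type} [Fintype α] [Fintype β]
  {wA : α → ℝ} {wB : β → ℝ} {wZ : Fin 2 → ℝ} {f : Fin 2 → Fin 2 → α → ℝ} {g : Fin 2 → Fin 2 → β → ℝ} {h : Fin 2 → α → β → ℝ}

/-- A ratio on the square from its four values `ρ i z` (`i` = c-level, `z` = hub level). [this work] -/
def rhoOf (r00 r01 r10 r11 : ℝ) : Fin 2 → Fin 2 → ℝ := ![![r00, r01], ![r10, r11]]

omit [Fintype α] [Fintype β] in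
/-- Values of `rhoOf`. [this work] -/
theorem rhoOf_val (r00 r01 r10 r11 : ℝ) :
    rhoOf r00 r01 r10 r11 0 0 = r00 ∧ rhoOf r00 r01 r10 r11 0 1 = r01 ∧ rhoOf r00 r01 r10 r11 1 0 = r10 ∧
      rhoOf r00 r01 r10 r11 1 1 = r11 := by
  refine ⟨rfl, rfl, rfl, rfl⟩

omit [Fintype β] in
/-- A section of mean zero kills its slices: `F_x = 0 ⟹ Y_x(b) = 0`. [this work] -/
theorem Ysl_eq_zero_of_Fm_eq_zero (hA0 : ∀ a, 0 ≤ wA a) (hf0 : ∀ i z a, 0 ≤ f i z a) {i z : Fin 2} (hz : Fm wA f i z = 0)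
    (b : β) : Ysl wA f h i z b = 0 := by
  unfold Ysl
  refine sum_eq_zero fun a _ => ?_
  have : wA a * f i z a = 0 := mul_eq_zero_of_Fm_eq_zero hA0 hf0 hz a
  calc wA a * (f i z a * h z a b) = (wA a * f i z a) * h z a b := by ring
    _ = 0 := by rw [this, zero_mul]

/-- **THEOREM (`I3 ≥ 0`).**  For FKG blocks `α, β`, nonnegative sections `f i z` (nested in `i`, increasing in `z`, monotone on `α`),
`g j z` likewise on `β`, and `h z ≥ 0` monotone in each block argument with `h 0 ≤ h 1`: the bias-free cross form is nonnegative,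
`0 ≤ crossForm wA wB f g h`. [this work] -/
theorem crossForm_nonneg [DistribLattice α] [DistribLattice β] (hA : IsFKGMeasure wA) (hB : IsFKGMeasure wB)
    (hf0 : ∀ i z a, 0 ≤ f i z a) (hfi : ∀ z a, f 0 z a ≤ f 1 z a) (hfa : ∀ i z, Monotone (f i z))
    (hfz : ∀ i a, f i 0 a ≤ f i 1 a)
    (hg0 : ∀ j z b, 0 ≤ g j z b) (hgj : ∀ z b, g 0 z b ≤ g 1 z b) (hgb : ∀ j z, Monotone (g j z))
    (hgz : ∀ j b, g j 0 b ≤ g j 1 b)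
    (hh0 : ∀ z a b, 0 ≤ h z a b) (hha : ∀ z b, Monotone (fun a => h z a b)) (hhb : ∀ z a, Monotone (h z a))
    (hhz : ∀ a b, h 0 a b ≤ h 1 a b) : 0 ≤ crossForm wA wB f g h := by
  have hA0 := hA.nonneg; have hB0 := hB.nonneg
  -- section means on the square: F0 = Fm 0 0, FZ = Fm 0 1, FC = Fm 1 0, FT = Fm 1 1
  have f0 : 0 ≤ Fm wA f 0 0 := Fm_nonneg hA0 hf0 0 0
  have f0Z : Fm wA f 0 0 ≤ Fm wA f 0 1 := by have := Fm_sub_nonneg hA0 hfz 0; linarith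
  have f0C : Fm wA f 0 0 ≤ Fm wA f 1 0 := Fm_mono_i hA0 hfi 0
  have fZT : Fm wA f 0 1 ≤ Fm wA f 1 1 := Fm_mono_i hA0 hfi 1
  have fCT : Fm wA f 1 0 ≤ Fm wA f 1 1 := by have := Fm_sub_nonneg hA0 hfz 1; linarith
  have g0Z : gm wB g 0 0 ≤ gm wB g 0 1 := by have := gm_sub_nonneg hB0 hgz 0; linarith
  have g0C : gm wB g 0 0 ≤ gm wB g 1 0 := gm_mono_j hB0 hgj 0
  have gZT : gm wB g 0 1 ≤ gm wB g 1 1 := gm_mono_j hB0 hgj 1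
  have gCT : gm wB g 1 0 ≤ gm wB g 1 1 := by have := gm_sub_nonneg hB0 hgz 1; linarith
  have hH01 : Hb wA wB h 0 ≤ Hb wA wB h 1 := by have := Hb_sub_nonneg hA0 hB0 hhz; linarith
  -- averaged slice bounds and monotonicity of the slice masses
  have sbT := Fm_mul_Hb_le_Ybar hA hB0 hf0 hfa hh0 hha 1 1
  have sbZ := Fm_mul_Hb_le_Ybar hA hB0 hf0 hfa hh0 hha 0 1
  have sbC := Fm_mul_Hb_le_Ybar hA hB0 hf0 hfa hh0 hha 1 0
  have mbTC := Ybar_mono_z hA0 hB0 hf0 hfz hh0 hhz 1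
  have mbTZ := Ybar_mono_i hA0 hB0 hfi hh0 1
  -- fibre facts
  have sl := Fm_mul_Hsl_le_Ysl (h := h) hA hf0 hfa hh0 hha
  have mI := Ysl_mono_i (h := h) hA0 hfi hh0
  have mZ := Ysl_mono_z hA0 hf0 hfz hh0 hhz
  have hH0 := Hsl_nonneg hA0 hh0 0
  have hHm := Hsl_mono_z hA0 hhz
  -- degenerate case F_T = 0: every slice vanishes
  by_cases hT : Fm wA f 1 1 = 0
  · have hall : ∀ i z, Fm wA f i z = 0 := by
      intro i z
      fin_cases i <;> fin_cases z <;> simp <;> linarith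
    have hY : ∀ i z b, Ysl wA f h i z b = 0 := fun i z b => Ysl_eq_zero_of_Fm_eq_zero hA0 hf0 (hall i z) b
    have hYb : ∀ i z, Ybar wA wB f h i z = 0 := fun i z => by
      unfold Ybar; exact sum_eq_zero fun b _ => by rw [hY]; ring
    refine crossForm_nonneg_of_square hB hA0 hf0 hg0 hgb hh0 hhb (ρ := fun _ _ => 0) (fun _ _ => le_refl _)
      (fun _ _ => zero_le_one) (fun b => ?_) ?_
    · simp [Sbox, hY, hall]
    · have : crossN wA wB f g = 0 := by unfold crossN; rw [hall, hall, hall, hall]; ring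
      simp [Rpart, hYb, hall, this]
  have hTpos : 0 < Fm wA f 1 1 := lt_of_le_of_ne (Fm_nonneg hA0 hf0 1 1) (Ne.symm hT)
  -- the four regimes
  by_cases hG : gm wB g 1 0 ≤ gm wB g 0 1
  · -- case A: G_C ≤ G_Z
    by_cases hF : Fm wA f 0 1 ≤ Fm wA f 1 0
    · -- rule A1: ρ = (0, 0, (F_C−F_Z)/F_T, 1−F_0/F_T)
      let ρ := rhoOf 0 0 ((Fm wA f 1 0 - Fm wA f 0 1) / Fm wA f 1 1) (1 - Fm wA f 0 0 / Fm wA f 1 1)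
      obtain ⟨e00, e01, e10, e11⟩ := rhoOf_val 0 0 ((Fm wA f 1 0 - Fm wA f 0 1) / Fm wA f 1 1) (1 - Fm wA f 0 0 / Fm wA f 1 1)
      have r10 : 0 ≤ (Fm wA f 1 0 - Fm wA f 0 1) / Fm wA f 1 1 := div_nonneg (sub_nonneg.2 hF) hTpos.le
      have r10' : (Fm wA f 1 0 - Fm wA f 0 1) / Fm wA f 1 1 ≤ 1 := by rw [div_le_one hTpos]; linarith
      have r11 : 0 ≤ 1 - Fm wA f 0 0 / Fm wA f 1 1 := by rw [sub_nonneg, div_le_one hTpos]; linarith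
      have r11' : 1 - Fm wA f 0 0 / Fm wA f 1 1 ≤ 1 := by have := div_nonneg f0 hTpos.le; linarith
      refine crossForm_nonneg_of_square hB hA0 hf0 hg0 hgb hh0 hhb (ρ := ρ) ?_ ?_ (fun b => ?_) ?_
      · intro i z
        fin_cases i <;> fin_cases z
        · exact le_refl _
        · exact le_refl _
        · exact r10
        · exact r11
      · intro i z
        fin_cases i <;> fin_cases z
        · exact zero_le_one
        · exact zero_le_one
        · exact r10'
        · exact r11'
      · show 0 ≤ Sbox wA f g h ρ b
        unfold Sbox; simp only [ρ, e00, e01, e10, e11]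
        exact sq_core (hg0 0 0 b) (hgz 0 b) (hgj 0 b) (hgj 1 b) (hgz 1 b)
          (patT hTpos f0 (sl 1 1 b) (mZ 0 b) (mI 1 b))
          (patZT_A1 hTpos f0 (le_trans f0 f0Z) hF fCT (sl 0 1 b) (sl 1 1 b) (mZ 0 b) (mZ 1 b))
          (patCT_A1 hTpos f0 (le_trans f0 f0Z) hF fCT (hH0 b) (sl 1 0 b) (sl 1 1 b) (mI 0 b) (mI 1 b))
          (patZCT hTpos f0 fZT fCT (hH0 b) (hHm b) (sl 1 0 b) (sl 1 1 b) (mZ 0 b) _ _)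
          (patAll f0Z fCT (hHm b) (sl 0 0 b) (sl 0 1 b) (sl 1 0 b) (sl 1 1 b) _ _ _ _)
      · rw [Rpart_eq]; unfold DT0 DZC; simp only [ρ, e00, e01, e10, e11]
        exact R_core_A (by linarith) (sub_nonneg.2 hG) (sub_nonneg.2 gZT) fZT hH01
          (DT0_rule hTpos (le_trans f0Z fZT) sbT) (DZC_A1 hTpos f0Z hF fCT sbT mbTC)
    · -- rule A2: ρ = (0, 1−F_C/F_Z, 0, 1−F_0/F_T), F_C < F_Z
      have hF' : Fm wA f 1 0 ≤ Fm wA f 0 1 := le_of_lt (not_le.mp hF)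
      have hZpos : 0 < Fm wA f 0 1 := lt_of_le_of_lt (Fm_nonneg hA0 hf0 1 0) (not_le.mp hF)
      let ρ := rhoOf 0 (1 - Fm wA f 1 0 / Fm wA f 0 1) 0 (1 - Fm wA f 0 0 / Fm wA f 1 1)
      obtain ⟨e00, e01, e10, e11⟩ := rhoOf_val 0 (1 - Fm wA f 1 0 / Fm wA f 0 1) 0 (1 - Fm wA f 0 0 / Fm wA f 1 1)
      have fC0 : 0 ≤ Fm wA f 1 0 := Fm_nonneg hA0 hf0 1 0
      have r01 : 0 ≤ 1 - Fm wA f 1 0 / Fm wA f 0 1 := by rw [sub_nonneg, div_le_one hZpos]; exact hF'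
      have r01' : 1 - Fm wA f 1 0 / Fm wA f 0 1 ≤ 1 := by have := div_nonneg fC0 hZpos.le; linarith
      have r11 : 0 ≤ 1 - Fm wA f 0 0 / Fm wA f 1 1 := by rw [sub_nonneg, div_le_one hTpos]; linarith
      have r11' : 1 - Fm wA f 0 0 / Fm wA f 1 1 ≤ 1 := by have := div_nonneg f0 hTpos.le; linarith
      refine crossForm_nonneg_of_square hB hA0 hf0 hg0 hgb hh0 hhb (ρ := ρ) ?_ ?_ (fun b => ?_) ?_
      · intro i z
        fin_cases i <;> fin_cases z
        · exact le_refl _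
        · exact r01
        · exact le_refl _
        · exact r11
      · intro i z
        fin_cases i <;> fin_cases z
        · exact zero_le_one
        · exact r01'
        · exact zero_le_one
        · exact r11'
      · show 0 ≤ Sbox wA f g h ρ b
        unfold Sbox; simp only [ρ, e00, e01, e10, e11]
        exact sq_core (hg0 0 0 b) (hgz 0 b) (hgj 0 b) (hgj 1 b) (hgz 1 b)
          (patT hTpos f0 (sl 1 1 b) (mZ 0 b) (mI 1 b))
          (patZT_A2 hTpos hZpos f0 fC0 (sl 0 1 b) (sl 1 1 b) (mZ 0 b) (mZ 1 b))
          (patCT_A2 hTpos hZpos f0 fC0 hF' fZT (hH0 b) (hHm b) (sl 1 0 b) (sl 1 1 b) (mI 0 b) (mI 1 b))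
          (patZCT hTpos f0 fZT fCT (hH0 b) (hHm b) (sl 1 0 b) (sl 1 1 b) (mZ 0 b) _ _)
          (patAll f0Z fCT (hHm b) (sl 0 0 b) (sl 0 1 b) (sl 1 0 b) (sl 1 1 b) _ _ _ _)
      · rw [Rpart_eq]; unfold DT0 DZC; simp only [ρ, e00, e01, e10, e11]
        exact R_core_A (by linarith) (sub_nonneg.2 hG) (sub_nonneg.2 gZT) fZT hH01
          (DT0_rule hTpos (le_trans f0Z fZT) sbT) (DZC_A2 hTpos hZpos (le_trans f0Z fZT) hF' sbT sbZ)
  · -- case B: G_Z < G_C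
    have hG' : gm wB g 0 1 ≤ gm wB g 1 0 := le_of_lt (not_le.mp hG)
    by_cases hF : Fm wA f 0 1 < Fm wA f 1 0
    · -- rule B1: ρ = (0, 0, (F_C−F_Z)/F_C, 1−F_0/F_T)
      have hCpos : 0 < Fm wA f 1 0 := lt_of_le_of_lt (le_trans f0 f0Z) hF
      let ρ := rhoOf 0 0 ((Fm wA f 1 0 - Fm wA f 0 1) / Fm wA f 1 0) (1 - Fm wA f 0 0 / Fm wA f 1 1)
      obtain ⟨e00, e01, e10, e11⟩ := rhoOf_val 0 0 ((Fm wA f 1 0 - Fm wA f 0 1) / Fm wA f 1 0) (1 - Fm wA f 0 0 / Fm wA f 1 1)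
      have r10 : 0 ≤ (Fm wA f 1 0 - Fm wA f 0 1) / Fm wA f 1 0 := div_nonneg (sub_nonneg.2 hF.le) hCpos.le
      have r10' : (Fm wA f 1 0 - Fm wA f 0 1) / Fm wA f 1 0 ≤ 1 := by
        rw [div_le_one hCpos]; linarith [le_trans f0 f0Z]
      have r11 : 0 ≤ 1 - Fm wA f 0 0 / Fm wA f 1 1 := by rw [sub_nonneg, div_le_one hTpos]; linarith
      have r11' : 1 - Fm wA f 0 0 / Fm wA f 1 1 ≤ 1 := by have := div_nonneg f0 hTpos.le; linarith
      refine crossForm_nonneg_of_square hB hA0 hf0 hg0 hgb hh0 hhb (ρ := ρ) ?_ ?_ (fun b => ?_) ?_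
      · intro i z
        fin_cases i <;> fin_cases z
        · exact le_refl _
        · exact le_refl _
        · exact r10
        · exact r11
      · intro i z
        fin_cases i <;> fin_cases z
        · exact zero_le_one
        · exact zero_le_one
        · exact r10'
        · exact r11'
      · show 0 ≤ Sbox wA f g h ρ b
        unfold Sbox; simp only [ρ, e00, e01, e10, e11]
        exact sq_core (hg0 0 0 b) (hgz 0 b) (hgj 0 b) (hgj 1 b) (hgz 1 b)
          (patT hTpos f0 (sl 1 1 b) (mZ 0 b) (mI 1 b))
          (patZT_B1 hTpos hCpos f0 (le_trans f0 f0Z) hF.le fCT (le_trans (hH0 b) (hHm b)) (sl 0 1 b) (sl 1 1 b) (mZ 0 b) (mZ 1 b))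
          (patCT_B1 hTpos hCpos f0 (le_trans f0 f0Z) (sl 1 0 b) (sl 1 1 b) (mI 0 b) (mI 1 b))
          (patZCT hTpos f0 fZT fCT (hH0 b) (hHm b) (sl 1 0 b) (sl 1 1 b) (mZ 0 b) _ _)
          (patAll f0Z fCT (hHm b) (sl 0 0 b) (sl 0 1 b) (sl 1 0 b) (sl 1 1 b) _ _ _ _)
      · rw [Rpart_eq]; unfold DT0 DZC; simp only [ρ, e00, e01, e10, e11]
        exact R_core_B (by linarith) (by linarith) (by linarith) fZT hH01
          (DT0_rule hTpos (le_trans f0Z fZT) sbT) (DZC_B1 hTpos hCpos (le_trans f0Z fZT) hF.le fCT hH01 sbT sbC)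
    · -- rule B2: ρ = (0, (F_Z−F_C)/F_T, 0, 1−F_0/F_T), F_C ≤ F_Z
      have hF' : Fm wA f 1 0 ≤ Fm wA f 0 1 := not_lt.mp hF
      let ρ := rhoOf 0 ((Fm wA f 0 1 - Fm wA f 1 0) / Fm wA f 1 1) 0 (1 - Fm wA f 0 0 / Fm wA f 1 1)
      obtain ⟨e00, e01, e10, e11⟩ := rhoOf_val 0 ((Fm wA f 0 1 - Fm wA f 1 0) / Fm wA f 1 1) 0 (1 - Fm wA f 0 0 / Fm wA f 1 1)
      have fC0 : 0 ≤ Fm wA f 1 0 := Fm_nonneg hA0 hf0 1 0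
      have r01 : 0 ≤ (Fm wA f 0 1 - Fm wA f 1 0) / Fm wA f 1 1 := div_nonneg (sub_nonneg.2 hF') hTpos.le
      have r01' : (Fm wA f 0 1 - Fm wA f 1 0) / Fm wA f 1 1 ≤ 1 := by rw [div_le_one hTpos]; linarith
      have r11 : 0 ≤ 1 - Fm wA f 0 0 / Fm wA f 1 1 := by rw [sub_nonneg, div_le_one hTpos]; linarith
      have r11' : 1 - Fm wA f 0 0 / Fm wA f 1 1 ≤ 1 := by have := div_nonneg f0 hTpos.le; linarith
      refine crossForm_nonneg_of_square hB hA0 hf0 hg0 hgb hh0 hhb (ρ := ρ) ?_ ?_ (fun b => ?_) ?_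
      · intro i z
        fin_cases i <;> fin_cases z
        · exact le_refl _
        · exact r01
        · exact le_refl _
        · exact r11
      · intro i z
        fin_cases i <;> fin_cases z
        · exact zero_le_one
        · exact r01'
        · exact zero_le_one
        · exact r11'
      · show 0 ≤ Sbox wA f g h ρ b
        unfold Sbox; simp only [ρ, e00, e01, e10, e11]
        have fZpos : 0 < Fm wA f 0 1 ∨ Fm wA f 0 1 = 0 := (lt_or_eq_of_le (le_trans f0 f0Z)).imp id Eq.symm
        rcases fZpos with hZpos | hZ0
        · exact sq_core (hg0 0 0 b) (hgz 0 b) (hgj 0 b) (hgj 1 b) (hgz 1 b)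
            (patT hTpos f0 (sl 1 1 b) (mZ 0 b) (mI 1 b))
            (patZT_B2 hTpos hZpos f0 fC0 hF' fZT (le_trans (hH0 b) (hHm b)) (sl 0 1 b) (sl 1 1 b) (mZ 0 b) (mZ 1 b))
            (patCT_B2 hTpos f0 hF' fZT f0C (hHm b) (sl 1 0 b) (sl 1 1 b) (mI 0 b) (mI 1 b))
            (patZCT hTpos f0 fZT fCT (hH0 b) (hHm b) (sl 1 0 b) (sl 1 1 b) (mZ 0 b) _ _)
            (patAll f0Z fCT (hHm b) (sl 0 0 b) (sl 0 1 b) (sl 1 0 b) (sl 1 1 b) _ _ _ _)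
        · -- F_Z = 0 forces F_C = F_0 = 0 and the `Z,C,0` slices vanish: only the `T`-terms survive
          have hC0 : Fm wA f 1 0 = 0 := le_antisymm (by linarith) fC0
          have h00 : Fm wA f 0 0 = 0 := le_antisymm (by linarith) f0
          have yZ := Ysl_eq_zero_of_Fm_eq_zero (h := h) hA0 hf0 hZ0 b
          have yC := Ysl_eq_zero_of_Fm_eq_zero (h := h) hA0 hf0 hC0 b
          have y0 := Ysl_eq_zero_of_Fm_eq_zero (h := h) hA0 hf0 h00 b
          rw [yZ, yC, y0, hZ0, hC0, h00]
          have gmn : g 0 0 b ≤ g 1 1 b := le_trans (hgz 0 b) (hgj 1 b)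
          have yT : Fm wA f 1 1 * Hsl wA h 0 b ≤ Ysl wA f h 1 1 b :=
            le_trans (mul_le_mul_of_nonneg_left (hHm b) hTpos.le) (sl 1 1 b)
          have hY11 : 0 ≤ Ysl wA f h 1 1 b := le_trans (mul_nonneg hTpos.le (hH0 b)) yT
          simp only [sub_self, zero_div, sub_zero, zero_mul, mul_zero, add_zero, zero_sub]
          nlinarith [mul_nonneg (sub_nonneg.2 gmn) hY11, mul_nonneg (hg0 0 0 b) (sub_nonneg.2 yT), hg0 0 0 b, hg0 1 1 b]
      · rw [Rpart_eq]; unfold DT0 DZC; simp only [ρ, e00, e01, e10, e11]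
        exact R_core_B (by linarith) (by linarith) (by linarith) fZT hH01
          (DT0_rule hTpos (le_trans f0Z fZT) sbT) (DZC_B2 hTpos hF' fZT f0C hH01 sbT mbTZ)

/-- **T₁(|C|=1): THE HUB TWO-LEVEL FORM IS NONNEGATIVE AT EVERY HUB BIAS** (for `[0,1]`-valued nested sections increasing in the
hub level, FKG blocks): `I3 ≥ 0` + the splitting identity + the one-level law (`twoLevel_nonneg_of_crossForm_nonneg'`). [this work] -/
theorem twoLevel_nonneg [DistribLattice α] [DistribLattice β] (hA : IsFKGMeasure wA) (hB : IsFKGMeasure wB)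
    (hZ0 : 0 ≤ wZ 0) (hZ1 : 0 ≤ wZ 1) (hZ : wZ 0 + wZ 1 = 1)
    (hf0 : ∀ i z a, 0 ≤ f i z a) (hf1 : ∀ i z a, f i z a ≤ 1) (hfi : ∀ z a, f 0 z a ≤ f 1 z a) (hfa : ∀ i z, Monotone (f i z))
    (hfz : ∀ i a, f i 0 a ≤ f i 1 a)
    (hg0 : ∀ j z b, 0 ≤ g j z b) (hg1 : ∀ j z b, g j z b ≤ 1) (hgj : ∀ z b, g 0 z b ≤ g 1 z b) (hgb : ∀ j z, Monotone (g j z))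
    (hgz : ∀ j b, g j 0 b ≤ g j 1 b)
    (hh0 : ∀ z a b, 0 ≤ h z a b) (hha : ∀ z b, Monotone (fun a => h z a b)) (hhb : ∀ z a, Monotone (h z a))
    (hhz : ∀ a b, h 0 a b ≤ h 1 a b) : 0 ≤ twoLevel wA wB wZ f g h :=
  twoLevel_nonneg_of_crossForm_nonneg' hA hB hZ0 hZ1 hZ hf0 hf1 hfi hfa hfz hg0 hg1 hgj hgb hgz hh0 hha hhb hhz
    (crossForm_nonneg hA hB hf0 hfi hfa hfz hg0 hgj hgb hgz hh0 hha hhb hhz)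

/-- **KAHN'S `C₃` (SAHI'S `E₃ ≥ 0`) ON THE CLASS T₁(|C|=1).**  Let `α, β` be finite distributive lattices with FKG probability weights
`wA, wB`, and let `(z,c) ∈ Fin 2 × Fin 2` carry an arbitrary product probability weight `wZ ⊗ wc`.  For `f(c,z,a)`, `g(c,z,b)` with values
in `[0,1]` and `h(z,a,b) ≥ 0`, all monotone in every argument,
`E₃(f,g,h) = 2E[fgh] − E f·E[gh] − E g·E[fh] − E h·E[fg] + E f·E g·E h ≥ 0` under `wA ⊗ wB ⊗ (wZ ⊗ wc)`.
(Two members share the two coins `z, c`; the third sees the hub `z` but not `c` — the class T₁(|C|=1) of the master-family programme,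
open through gens 25–28; the z-dominated half was `…SahiT1LexChain`.) [this work] -/
theorem sahiE_three_nonneg_T1C1 [DistribLattice α] [DistribLattice β] (hA : IsFKGMeasure wA) (hB : IsFKGMeasure wB)
    {wc : Fin 2 → ℝ} (hZ0 : ∀ z, 0 ≤ wZ z) (hZ1 : ∑ z, wZ z = 1) (hc0 : ∀ c, 0 ≤ wc c) (hc1 : wc 0 + wc 1 = 1)
    (hf0 : ∀ i z a, 0 ≤ f i z a) (hf1 : ∀ i z a, f i z a ≤ 1) (hfi : ∀ z a, f 0 z a ≤ f 1 z a) (hfa : ∀ i z, Monotone (f i z))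
    (hfz : ∀ i a, Monotone (fun z => f i z a))
    (hg0 : ∀ j z b, 0 ≤ g j z b) (hg1 : ∀ j z b, g j z b ≤ 1) (hgj : ∀ z b, g 0 z b ≤ g 1 z b) (hgb : ∀ j z, Monotone (g j z))
    (hgz : ∀ j b, Monotone (fun z => g j z b))
    (hh0 : ∀ z a b, 0 ≤ h z a b) (hhz : ∀ a b, Monotone (fun z => h z a b)) (hha : ∀ z b, Monotone (fun a => h z a b))
    (hhb : ∀ z a, Monotone (h z a)) :
    0 ≤ sahiE (fun q : α × β × (Fin 2 × Fin 2) => wA q.1 * wB q.2.1 * (wZ q.2.2.1 * wc q.2.2.2)) 3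
        ![fun q => f q.2.2.2 q.2.2.1 q.1, fun q => g q.2.2.2 q.2.2.1 q.2.1, fun q => h q.2.2.1 q.1 q.2.1] := by
  have hZ01 : wZ 0 + wZ 1 = 1 := by have := hZ1; rw [Fin.sum_univ_two] at this; exact this
  exact sahiE_three_nonneg_T1C1_of_twoLevel_nonneg hA hB hZ0 hZ1 hc0 hc1 hf0 hfa hfz hg0 hgb hgz hh0 hhz hha hhb
    (twoLevel_nonneg hA hB (hZ0 0) (hZ0 1) hZ01 hf0 hf1 hfi hfa (fun i a => hfz i a (by decide)) hg0 hg1 hgj hgb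
      (fun j b => hgz j b (by decide)) hh0 hha hhb (fun a b => hhz a b (by decide)))

end Main

end SahiHubTwoLevel

end Summit.CriticalPhenomena.PercolationContinuityZ3.Theorems
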